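import Literature.Analysis.ValidatedNumerics.MultiPrecisionInterval
import HarnessLib

/-!
# Format C, design C∞ (E2, data side): DOMINATION of a boxed quadratic form by a rational one

Route context: Fourier–Galerkin / Schur-complement certificates of Weil positivity on a window ("format C", C∞ door;
cell memo `run/shared/lean/pub/rh-explicit/rh-explicit-weil-2/gen15/E2-PLAN-v2.md` §5.3 (E2e); supporting stmt-RiemannHypothesis-0098;
seat rh-explicit-weil-2).  The door `weilPositivityOn_of_cinf_poly` accepts ANY quadratic form `Uq` dominating the explicit
majorant `Ufin + ((1+θ)Γ(A·z) + …)/d₁` (hypothesis `hUqe'`), whose coefficients `Q_{kk'}` (the Gram of the composite families,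
`AᵀHA` plus remainder terms) are real numbers known to the kernel only through BOXES.  The generator emits a RATIONAL matrix `M`;
this file is the one inequality that turns entrywise boxes into domination:

* `sum_mul_mul_abs_le_sum_sq` — `Σ_{k,k'} r_{kk'}|z_k||z_{k'}| ≤ Σ_k ((Σ_{k'} r_{kk'} + Σ_{k'} r_{k'k})/2) z_k²` (`r ≥ 0`; AM–GM);
* `quadForm_le_of_abs_sub_le` — `|Q_{kk'} − Q̂_{kk'}| ≤ r_{kk'}` ⇒ `zᵀQz ≤ zᵀQ̂z + Σ_k c_k z_k²` with that `c`;
* `quadForm_le_of_boxes` — if moreover `zᵀ(M − Q̂)z − Σ_k c_k z_k² ≥ 0` for all `z` (a rational PSD certificate, e.g.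
  `PsdDyadic`), then `zᵀQz ≤ zᵀMz` for all `z`.

Finite-dimensional real algebra; standard axioms; no RH claim.
-/

set_option autoImplicit false
-- `Summit.RiemannHypothesis.RiemannHypothesis.…` is the layout-mandated namespace (summit = problem name).
set_option linter.dupNamespace false

open Finset

namespace Summit.RiemannHypothesis.RiemannHypothesis.Theorems.WeilFormatC

namespace CinfCoeff

variable {κ : Type*} [Fintype κ]

/-- **AM–GM absorption of an entrywise radius matrix**: for `r ≥ 0`,
`Σ_{k,k'} r_{kk'}|z_k||z_{k'}| ≤ Σ_k ((Σ_{k'} r_{kk'} + Σ_{k'} r_{k'k})/2)·z_k²`. -/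
theorem sum_mul_mul_abs_le_sum_sq (r : κ → κ → ℝ) (hr : ∀ k k', 0 ≤ r k k') (z : κ → ℝ) :
    ∑ k, ∑ k', r k k' * |z k| * |z k'| ≤ ∑ k, ((∑ k', r k k' + ∑ k', r k' k) / 2) * z k ^ 2 := by
  have hpt : ∀ k k', r k k' * |z k| * |z k'| ≤ r k k' / 2 * z k ^ 2 + r k k' / 2 * z k' ^ 2 := by
    intro k k'
    have h2 : 2 * |z k| * |z k'| ≤ |z k| ^ 2 + |z k'| ^ 2 := two_mul_le_add_sq (|z k|) (|z k'|)
    rw [sq_abs, sq_abs] at h2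
    have := hr k k'
    nlinarith
  calc ∑ k, ∑ k', r k k' * |z k| * |z k'|
      ≤ ∑ k, ∑ k', (r k k' / 2 * z k ^ 2 + r k k' / 2 * z k' ^ 2) :=
        Finset.sum_le_sum fun k _ ↦ Finset.sum_le_sum fun k' _ ↦ hpt k k'
    _ = ∑ k, ∑ k', r k k' / 2 * z k ^ 2 + ∑ k, ∑ k', r k k' / 2 * z k' ^ 2 := by
        simp only [Finset.sum_add_distrib]
    _ = ∑ k, ∑ k', r k k' / 2 * z k ^ 2 + ∑ k, ∑ k', r k' k / 2 * z k ^ 2 := by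
        congr 1
        exact Finset.sum_comm
    _ = ∑ k, ((∑ k', r k k' + ∑ k', r k' k) / 2) * z k ^ 2 := by
        rw [← Finset.sum_add_distrib]
        refine Finset.sum_congr rfl fun k _ ↦ ?_
        rw [← Finset.sum_mul, ← Finset.sum_mul, ← Finset.sum_div, ← Finset.sum_div]
        ring

/-- **Boxed form vs midpoint form**: `|Q_{kk'} − Q̂_{kk'}| ≤ r_{kk'}` gives
`zᵀQz ≤ zᵀQ̂z + Σ_k ((Σ_{k'} r_{kk'} + Σ_{k'} r_{k'k})/2) z_k²`. -/
theorem quadForm_le_of_abs_sub_le (Q Qm r : κ → κ → ℝ) (hr : ∀ k k', |Q k k' - Qm k k'| ≤ r k k') (z : κ → ℝ) :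
    ∑ k, ∑ k', z k * z k' * Q k k'
      ≤ ∑ k, ∑ k', z k * z k' * Qm k k' + ∑ k, ((∑ k', r k k' + ∑ k', r k' k) / 2) * z k ^ 2 := by
  have hr0 : ∀ k k', 0 ≤ r k k' := fun k k' ↦ (abs_nonneg _).trans (hr k k')
  have hdiff : ∑ k, ∑ k', z k * z k' * Q k k' - ∑ k, ∑ k', z k * z k' * Qm k k'
      ≤ ∑ k, ∑ k', r k k' * |z k| * |z k'| := by
    rw [← Finset.sum_sub_distrib]
    refine Finset.sum_le_sum fun k _ ↦ ?_
    rw [← Finset.sum_sub_distrib]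
    refine Finset.sum_le_sum fun k' _ ↦ ?_
    have e : z k * z k' * Q k k' - z k * z k' * Qm k k' = z k * z k' * (Q k k' - Qm k k') := by ring
    rw [e]
    calc z k * z k' * (Q k k' - Qm k k') ≤ |z k * z k' * (Q k k' - Qm k k')| := le_abs_self _
      _ = |z k| * |z k'| * |Q k k' - Qm k k'| := by rw [abs_mul, abs_mul]
      _ ≤ |z k| * |z k'| * r k k' := mul_le_mul_of_nonneg_left (hr k k') (by positivity)
      _ = r k k' * |z k| * |z k'| := by ring
  have h := sum_mul_mul_abs_le_sum_sq r hr0 z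
  linarith

/-- **Domination from boxes + a rational PSD certificate**: if `|Q − Q̂| ≤ r` entrywise and
`zᵀ(M − Q̂)z ≥ Σ_k c_k z_k²` for all `z` (with `c` the AM–GM weights of `r`), then `zᵀQz ≤ zᵀMz` for all `z`.  This is the
shape in which the C∞ door's dominating `Uq` (a rational matrix `M` from the generator) absorbs the boxed Gram of the composite
families. -/
theorem quadForm_le_of_boxes (Q Qm r M : κ → κ → ℝ) (hr : ∀ k k', |Q k k' - Qm k k'| ≤ r k k')
    (hM : ∀ z : κ → ℝ, ∑ k, ((∑ k', r k k' + ∑ k', r k' k) / 2) * z k ^ 2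
      ≤ ∑ k, ∑ k', z k * z k' * (M k k' - Qm k k')) (z : κ → ℝ) :
    ∑ k, ∑ k', z k * z k' * Q k k' ≤ ∑ k, ∑ k', z k * z k' * M k k' := by
  have h1 := quadForm_le_of_abs_sub_le Q Qm r hr z
  have h2 := hM z
  have e : ∑ k, ∑ k', z k * z k' * (M k k' - Qm k k')
      = ∑ k, ∑ k', z k * z k' * M k k' - ∑ k, ∑ k', z k * z k' * Qm k k' := by
    rw [← Finset.sum_sub_distrib]
    refine Finset.sum_congr rfl fun k _ ↦ ?_
    rw [← Finset.sum_sub_distrib]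
    exact Finset.sum_congr rfl fun k' _ ↦ by ring
  rw [e] at h2
  linarith

end CinfCoeff

end Summit.RiemannHypothesis.RiemannHypothesis.Theorems.WeilFormatC
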